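import Literature.MathematicalPhysics.KineticTheory.LangevinChainSDE
import Literature.Analysis.ODE.ForcedSmoothDependence
import Literature.Analysis.ODE.LinearGrowth
import Mathlib.Topology.ContinuousMap.Algebra
import HarnessLib

/-!
# Differentiability of the pathwise Langevin flow in finitely many forcing parameters

Trunk T-KINETIC (Literature/MathematicalPhysics/KineticTheory). Support file for the provefact unit
of `CuneoEckmannHairerReyBellet2018_pinnedChain` (second seat: absolute continuity of the transition
probabilities of the Langevin-driven chain without Hörmander's theorem, by a finite-dimensional
"partial Malliavin" argument). Everything is PROVED; no named facts.

The pathwise solution `OscillatorChain.chainFlow` of the pinned chain (`LangevinChainSDE.lean`)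
solves the forced integral equation `z(t) = z₀ + (0, η(t)) + ∫₀ᵗ Y(z(s)) ds` for every continuous
momentum-noise path `η`. Here the noise is perturbed by a finite-dimensional LINEAR family,
`η_x = η₀ + H x` with `H : X →L C([0,1], ℝ^N)` (`perturbedNoise`), and the dependence of the
solution on the parameter `x` is analysed with `Literature/Analysis/ODE/ForcedSmoothDependence.lean`:

* `pinnedChainSolCurve … x ∈ C([0,1], PhaseSpace N)` — the solution curve on `[0,1]`; it is a zero
  of the parametric Robbin map of the forcing curve `g(x) = z + (0, η₀ + H x)` (`forcingCurve`,
  affine and smooth in `x`): `forcedRobbinMap_pinnedChainSolCurve` (from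
  `pinnedChain_isIntegralSolutionOn_chainFlow`), and the ONLY zero
  (`eq_pinnedChainSolCurve_of_forcedRobbinMap_eq_zero`, from Grönwall uniqueness
  `pinnedChain_eqOn_chainFlow`);
* `contDiff_pinnedChainSolCurve`, `contDiff_chainFlow_perturbedNoise_one` — **the solution curve,
  and the flow at time `1`, are `C^∞` functions of the forcing parameters**;
* `pinnedChainVariation … x δ` — the variational solution `w_δ = D_x(solution curve) δ` (extended
  by constants to `ℝ`), solving the **linearised integral equation**
  `w_δ(τ) = (0, (Hδ)(τ)) + ∫₀^τ DY(z_x(s)) w_δ(s) ds` on `[0,1]` (`pinnedChainVariation_eq`), and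
  `hasFDerivAt_chainFlow_perturbedNoise_one` / `fderiv_chainFlow_perturbedNoise_one_apply`:
  **`D_x[chainFlow z η_x 1] δ = w_δ(1)`**;
* `exists_linearODE_solution_of_continuous` — global solutions `ċ = M(s)c` through any point, for
  continuous operator coefficients (a corollary of the tree's
  `Literature.Analysis.ODE.exists_solution_of_linearGrowth_at`; the costates of the linearised
  flow).

## References

* N. Cuneo, J.-P. Eckmann, M. Hairer, L. Rey-Bellet, EJP 23 (2018) no. 55, §2 eq. (2.2) (the
  additive-noise SDE solved path by path). [folklore]

## Design choices

* Parameters live in an arbitrary Banach space `X : Type` and enter through a continuous linear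
  map into `C([0,1], ℝ^N)` (momentum forcing only, as for the Langevin baths); the consumer takes
  `X = ` the space of dyadic skeletons of the Brownian pair and `H` the piecewise-linear
  interpolation at the two bath sites.
* Time horizon `1` (the transition probability `P_1`); the flow at time `1` depends on the noise
  on `[0,1]` only, so the extension of `H x` by constants outside `[0,1]` is immaterial.
-/

noncomputable section

open MeasureTheory Filter Topology Set Function unitInterval
open scoped ContDiff NNReal

namespace Literature.MathematicalPhysics.KineticTheory.HeatConduction

open OscillatorChain Literature.Analysis.ODE

variable {N : ℕ}

/-! ### Global solutions of linear equations `ċ = M(s) c` with continuous coefficients (costates) -/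

/-- **Linear differential equations with continuous operator coefficients have global
solutions through every point**: a corollary of the tree's
`Literature.Analysis.ODE.exists_solution_of_linearGrowth_at` (a continuous `M` is bounded on
every `[-T, T]`, hence `x ↦ M(t) x` is Lipschitz and of linear growth there). Used to produce
the costates `ċ = G(ζ(s)) c`, `c(1) = c₁`, of the linearised flow. [folklore] -/
theorem exists_linearODE_solution_of_continuous {E : Type*} [NormedAddCommGroup E]
    [NormedSpace ℝ E] [CompleteSpace E] (M : ℝ → E →L[ℝ] E) (hM : Continuous M) (s₀ : ℝ) (c₁ : E) :
    ∃ c : ℝ → E, c s₀ = c₁ ∧ ∀ t, HasDerivAt c (M t (c t)) t := by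
  refine Literature.Analysis.ODE.exists_solution_of_linearGrowth_at (v := fun t x => M t x)
    (fun T => ?_) (fun x => hM.clm_apply continuous_const) s₀ c₁
  obtain ⟨K₀, hK₀⟩ := isCompact_Icc.exists_bound_of_continuousOn (hM.continuousOn (s := Icc (-T) T))
  refine ⟨K₀.toNNReal, fun t ht => ⟨(M t).lipschitz.weaken ?_, fun x => ?_⟩⟩
  · rw [← norm_toNNReal]
    exact Real.toNNReal_le_toNNReal (hK₀ t ht)
  · exact ((M t).le_opNorm x).trans
      (mul_le_mul_of_nonneg_right ((hK₀ t ht).trans (Real.le_coe_toNNReal K₀)) (norm_nonneg x))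

/-! ### Perturbed noise paths and the associated forcing curves -/

/-- The **perturbed noise path** `η_x = η₀ + (H x)` of a base momentum-noise path `η₀` by the
finite-dimensional linear family `H : X →L C([0,1], ℝ^N)` (the perturbation, a continuous function
on `[0, 1]`, is extended by constants to `ℝ`; only `[0,1]` matters for the flow at time `1`).
[folklore] -/
def perturbedNoise {X : Type*} [NormedAddCommGroup X] [NormedSpace ℝ X] (η₀ : ℝ → Fin N → ℝ)
    (H : X →L[ℝ] C(I, Fin N → ℝ)) (x : X) (t : ℝ) : Fin N → ℝ :=
  η₀ t + IccExtend zero_le_one (H x) t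

/-- The perturbed noise is continuous. [folklore] -/
theorem continuous_perturbedNoise {X : Type*} [NormedAddCommGroup X] [NormedSpace ℝ X]
    {η₀ : ℝ → Fin N → ℝ} (hη₀ : Continuous η₀) (H : X →L[ℝ] C(I, Fin N → ℝ)) (x : X) :
    Continuous (perturbedNoise η₀ H x) :=
  hη₀.add ((map_continuous (H x)).Icc_extend')

/-- On `[0, 1]` the perturbed noise is `η₀ t + (H x) t`. [folklore] -/
theorem perturbedNoise_of_mem {X : Type*} [NormedAddCommGroup X] [NormedSpace ℝ X]
    (η₀ : ℝ → Fin N → ℝ) (H : X →L[ℝ] C(I, Fin N → ℝ)) (x : X) {t : ℝ} (ht : t ∈ Icc (0 : ℝ) 1) :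
    perturbedNoise η₀ H x t = η₀ t + H x ⟨t, ht⟩ := by
  rw [perturbedNoise, IccExtend_of_mem _ _ ht]

/-- The lift `f ↦ (τ ↦ (0, f τ))` of a momentum path to a phase-space path, a continuous linear map
`C(I, ℝ^N) →L C(I, PhaseSpace N)`. [folklore] -/
def momentumLift (N : ℕ) : C(I, Fin N → ℝ) →L[ℝ] C(I, PhaseSpace N) :=
  (ContinuousLinearMap.inr ℝ (Fin N → ℝ) (Fin N → ℝ)).compLeftContinuous ℝ I

/-- Unfolding `momentumLift`. [folklore] -/
@[simp] theorem momentumLift_apply (f : C(I, Fin N → ℝ)) (τ : I) :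
    momentumLift N f τ = ((0 : Fin N → ℝ), f τ) := rfl

/-- The base forcing curve `τ ↦ z + (0, η₀ τ)` on `[0, 1]`. [folklore] -/
def baseForcingCurve (z : PhaseSpace N) {η₀ : ℝ → Fin N → ℝ} (hη₀ : Continuous η₀) :
    C(I, PhaseSpace N) :=
  ⟨fun τ => z + ((0 : Fin N → ℝ), η₀ τ), by fun_prop⟩

/-- The **forcing curve** of the perturbed integral equation, `g(x)(τ) = z + (0, η₀ τ + (H x) τ)`,
an affine continuous function of the parameter `x`. [folklore] -/
def forcingCurve (z : PhaseSpace N) {η₀ : ℝ → Fin N → ℝ} (hη₀ : Continuous η₀)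
    {X : Type*} [NormedAddCommGroup X] [NormedSpace ℝ X] (H : X →L[ℝ] C(I, Fin N → ℝ)) (x : X) :
    C(I, PhaseSpace N) :=
  baseForcingCurve z hη₀ + momentumLift N (H x)

/-- `g(x)(τ) = forcing z η_x τ` on `[0, 1]`. [folklore] -/
theorem forcingCurve_apply (z : PhaseSpace N) {η₀ : ℝ → Fin N → ℝ} (hη₀ : Continuous η₀)
    {X : Type*} [NormedAddCommGroup X] [NormedSpace ℝ X] (H : X →L[ℝ] C(I, Fin N → ℝ)) (x : X)
    (τ : I) : forcingCurve z hη₀ H x τ = forcing z (perturbedNoise η₀ H x) τ := by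
  simp only [forcingCurve, baseForcingCurve, ContinuousMap.add_apply, ContinuousMap.coe_mk,
    momentumLift_apply, forcing, perturbedNoise_of_mem η₀ H x τ.2, Prod.mk_add_mk, add_zero,
    add_assoc]

/-- The forcing curve is smooth in the parameter (affine continuous). [folklore] -/
theorem contDiff_forcingCurve (z : PhaseSpace N) {η₀ : ℝ → Fin N → ℝ} (hη₀ : Continuous η₀)
    {X : Type*} [NormedAddCommGroup X] [NormedSpace ℝ X] (H : X →L[ℝ] C(I, Fin N → ℝ)) {n : ℕ∞} :
    ContDiff ℝ n (forcingCurve z hη₀ H) :=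
  contDiff_const.add ((momentumLift N).comp H).contDiff

/-- The derivative of the forcing curve: `Dg(x) δ = (τ ↦ (0, (H δ) τ))`. [folklore] -/
theorem fderiv_forcingCurve (z : PhaseSpace N) {η₀ : ℝ → Fin N → ℝ} (hη₀ : Continuous η₀)
    {X : Type*} [NormedAddCommGroup X] [NormedSpace ℝ X] (H : X →L[ℝ] C(I, Fin N → ℝ)) (x δ : X) :
    fderiv ℝ (forcingCurve z hη₀ H) x δ = momentumLift N (H δ) := by
  have h : HasFDerivAt (forcingCurve z hη₀ H) ((momentumLift N).comp H) x :=
    ((momentumLift N).comp H).hasFDerivAt.const_add (baseForcingCurve z hη₀)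
  rw [h.fderiv]
  rfl

/-! ### The flow of the pinned chain as a curve-valued function of the forcing parameters -/

section Pinned

variable {ω₂ lam β γ : ℝ} (hω : 0 < ω₂) (hl : 0 ≤ lam) (hβ : 0 ≤ β) (hγ : 0 ≤ γ)
  (N : ℕ) (z : PhaseSpace N) {η₀ : ℝ → Fin N → ℝ} (hη₀ : Continuous η₀)
  {X : Type} [NormedAddCommGroup X] [NormedSpace ℝ X]
  (H : X →L[ℝ] C(I, Fin N → ℝ))

/-- The solution curve on `[0, 1]` of the pinned chain driven by the perturbed noise `η_x`, as an
element of `C([0,1], PhaseSpace N)`. [folklore] -/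
def pinnedChainSolCurve (x : X) : C(I, PhaseSpace N) :=
  ⟨fun τ => (pinnedChain ω₂ lam β γ).chainFlow N z (perturbedNoise η₀ H x) τ,
    (pinnedChain_continuous_chainFlow hω hl hβ hγ N z (continuous_perturbedNoise hη₀ H x)).comp
      continuous_subtype_val⟩

include hω hl hβ hγ hη₀ in
/-- Unfolding `pinnedChainSolCurve`. [folklore] -/
@[simp] theorem pinnedChainSolCurve_apply (x : X) (τ : I) :
    pinnedChainSolCurve hω hl hβ hγ N z hη₀ H x τ =
      (pinnedChain ω₂ lam β γ).chainFlow N z (perturbedNoise η₀ H x) τ := rfl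

/-- **The solution curves are zeros of the parametric Robbin map** (the integral equation (IE) on
`[0, 1]`, `pinnedChain_isIntegralSolutionOn_chainFlow`). [folklore] -/
theorem forcedRobbinMap_pinnedChainSolCurve (x : X) :
    forcedRobbinMap ((pinnedChain ω₂ lam β γ).drift N) (forcingCurve z hη₀ H)
      (x, pinnedChainSolCurve hω hl hβ hγ N z hη₀ H x) = 0 := by
  set P := pinnedChain ω₂ lam β γ with hP
  have hY : Continuous (P.drift N) := (pinnedChain_contDiff_drift ω₂ lam β γ N (n := 0)).continuous
  rw [forcedRobbinMap_eq_zero_iff]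
  intro τ
  have hsol := pinnedChain_isIntegralSolutionOn_chainFlow hω hl hβ hγ N z
    (continuous_perturbedNoise hη₀ H x) 1 τ τ.2
  rw [pinnedChainSolCurve_apply, forcingCurve_apply, hsol]
  congr 1
  refine intervalIntegral.integral_congr fun s hs => ?_
  have hs' : s ∈ Icc (0 : ℝ) 1 := by
    rw [uIcc_of_le τ.2.1] at hs
    exact ⟨hs.1, hs.2.trans τ.2.2⟩
  rw [IccExtend_nemytskii_of_mem hY _ hs']
  rfl

/-- **Uniqueness**: every zero of the parametric Robbin map is the solution curve (Grönwall,
`pinnedChain_eqOn_chainFlow`). [folklore] -/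
theorem eq_pinnedChainSolCurve_of_forcedRobbinMap_eq_zero (x : X) (α : C(I, PhaseSpace N))
    (h : forcedRobbinMap ((pinnedChain ω₂ lam β γ).drift N) (forcingCurve z hη₀ H) (x, α) = 0) :
    α = pinnedChainSolCurve hω hl hβ hγ N z hη₀ H x := by
  set P := pinnedChain ω₂ lam β γ with hP
  have hY : Continuous (P.drift N) := (pinnedChain_contDiff_drift ω₂ lam β γ N (n := 0)).continuous
  rw [forcedRobbinMap_eq_zero_iff] at h
  -- the extension of `α` by constants solves (IE) on `[0, 1]`
  set zα : ℝ → PhaseSpace N := IccExtend zero_le_one α with hzα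
  have hzαc : Continuous zα := (map_continuous α).Icc_extend'
  have hsol : IsIntegralSolutionOn (P.drift N) (forcing z (perturbedNoise η₀ H x)) zα 1 := by
    intro t ht
    rw [hzα, IccExtend_of_mem _ _ ht, h ⟨t, ht⟩, forcingCurve_apply]
    congr 1
    refine intervalIntegral.integral_congr fun s hs => ?_
    have hs' : s ∈ Icc (0 : ℝ) 1 := by
      rw [uIcc_of_le ht.1] at hs
      exact ⟨hs.1, hs.2.trans ht.2⟩
    simp only [IccExtend_nemytskii_of_mem hY _ hs', IccExtend_of_mem _ _ hs']
  have heq := pinnedChain_eqOn_chainFlow hω hl hβ hγ N z (continuous_perturbedNoise hη₀ H x) hsol hzαc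
  ext τ : 1
  have := heq τ.2
  rw [hzα, IccExtend_of_mem _ _ τ.2] at this
  simpa using this

/-- **The variational solution** in the direction `δ`: the derivative of the solution curve,
extended by constants to `ℝ`. [folklore] -/
def pinnedChainVariation (x δ : X) : ℝ → PhaseSpace N :=
  IccExtend zero_le_one (fderiv ℝ (pinnedChainSolCurve hω hl hβ hγ N z hη₀ H) x δ)

/-- The variational solution is continuous. [folklore] -/
theorem continuous_pinnedChainVariation (x δ : X) :
    Continuous (pinnedChainVariation hω hl hβ hγ N z hη₀ H x δ) :=
  (map_continuous _).Icc_extend'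

variable [CompleteSpace X]

/-- **The solution curve depends smoothly on the forcing parameters** (`C^∞` as a map
`X → C([0,1], PhaseSpace N)`; `contDiffAt_forcedSolution_family`). [folklore] -/
theorem contDiff_pinnedChainSolCurve : ContDiff ℝ ∞ (pinnedChainSolCurve hω hl hβ hγ N z hη₀ H) :=
  contDiff_iff_contDiffAt.2 fun x =>
    contDiffAt_forcedSolution_family (n := ⊤) (pinnedChain_contDiff_drift ω₂ lam β γ N)
      (contDiff_forcingCurve z hη₀ H) le_top (forcedRobbinMap_pinnedChainSolCurve hω hl hβ hγ N z hη₀ H)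
      (eq_pinnedChainSolCurve_of_forcedRobbinMap_eq_zero hω hl hβ hγ N z hη₀ H) x

include hω hl hβ hγ hη₀ in
/-- **The flow at time `1` is a `C^∞` function of the forcing parameters.** [folklore] -/
theorem contDiff_chainFlow_perturbedNoise_one :
    ContDiff ℝ ∞ fun x : X => (pinnedChain ω₂ lam β γ).chainFlow N z (perturbedNoise η₀ H x) 1 := by
  have h := (ContinuousMap.evalCLM ℝ (1 : I)).contDiff.comp
    (contDiff_pinnedChainSolCurve hω hl hβ hγ N z hη₀ H)
  exact h

/-- **The variational (linearised) integral equation**: for `τ ∈ [0, 1]`,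
`w_δ(τ) = (0, (H δ)(τ)) + ∫₀^τ DY(z_x(s)) w_δ(s) ds`, `z_x = chainFlow z η_x`. [folklore] -/
theorem pinnedChainVariation_eq (x δ : X) {τ : ℝ} (hτ : τ ∈ Icc (0 : ℝ) 1) :
    pinnedChainVariation hω hl hβ hγ N z hη₀ H x δ τ =
      (((0 : Fin N → ℝ), H δ ⟨τ, hτ⟩) : PhaseSpace N) +
        ∫ s in (0 : ℝ)..τ, fderiv ℝ ((pinnedChain ω₂ lam β γ).drift N)
          ((pinnedChain ω₂ lam β γ).chainFlow N z (perturbedNoise η₀ H x) s)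
          (pinnedChainVariation hω hl hβ hγ N z hη₀ H x δ s) := by
  have hY : ContDiff ℝ (⊤ : ℕ∞) ((pinnedChain ω₂ lam β γ).drift N) :=
    pinnedChain_contDiff_drift ω₂ lam β γ N
  have hv := fderiv_forcedSolution_family_apply (n := ⊤) hY (contDiff_forcingCurve z hη₀ H) le_top
    (forcedRobbinMap_pinnedChainSolCurve hω hl hβ hγ N z hη₀ H)
    (eq_pinnedChainSolCurve_of_forcedRobbinMap_eq_zero hω hl hβ hγ N z hη₀ H) x δ ⟨τ, hτ⟩
  rw [pinnedChainVariation, IccExtend_of_mem _ _ hτ, hv, fderiv_forcingCurve, momentumLift_apply]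
  congr 1
  refine intervalIntegral.integral_congr fun s hs => ?_
  have hs' : s ∈ Icc (0 : ℝ) 1 := by
    rw [uIcc_of_le hτ.1] at hs
    exact ⟨hs.1, hs.2.trans hτ.2⟩
  simp only [IccExtend_applyCLM_nemytskii_fderiv_of_mem hY le_top _ _ hs', IccExtend_of_mem _ _ hs',
    pinnedChainSolCurve_apply]

/-- **The derivative of the time-`1` flow in the forcing parameters is the endpoint of the
variational solution**: `D_x[chainFlow z η_x 1] δ = w_δ(1)`. [folklore] -/
theorem hasFDerivAt_chainFlow_perturbedNoise_one (x : X) :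
    HasFDerivAt (fun x : X => (pinnedChain ω₂ lam β γ).chainFlow N z (perturbedNoise η₀ H x) 1)
      ((ContinuousMap.evalCLM ℝ (1 : I)).comp
        (fderiv ℝ (pinnedChainSolCurve hω hl hβ hγ N z hη₀ H) x)) x := by
  have hd : DifferentiableAt ℝ (pinnedChainSolCurve hω hl hβ hγ N z hη₀ H) x :=
    (contDiff_pinnedChainSolCurve hω hl hβ hγ N z hη₀ H).differentiable (by simp) x
  exact (ContinuousMap.evalCLM ℝ (1 : I)).hasFDerivAt.comp x hd.hasFDerivAt

/-- The derivative applied to `δ` is `w_δ(1)`. [folklore] -/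
theorem fderiv_chainFlow_perturbedNoise_one_apply (x δ : X) :
    fderiv ℝ (fun x : X => (pinnedChain ω₂ lam β γ).chainFlow N z (perturbedNoise η₀ H x) 1) x δ =
      pinnedChainVariation hω hl hβ hγ N z hη₀ H x δ 1 := by
  rw [(hasFDerivAt_chainFlow_perturbedNoise_one hω hl hβ hγ N z hη₀ H x).fderiv,
    ContinuousLinearMap.comp_apply, ContinuousMap.evalCLM_apply, pinnedChainVariation,
    IccExtend_of_mem _ _ (right_mem_Icc.2 zero_le_one)]
  rfl

end Pinned

end Literature.MathematicalPhysics.KineticTheory.HeatConduction
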